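import Literature.AlgebraicGeometry.Morphisms.SectionsLiftOfFibreVanishing
import HarnessLib

/-!
# `H⁰` commutes with every base change when `H¹` of the closed fibre vanishes (the injectivity half)

[cite: MumfordAV1970, §5, Lemma 2 (p. 49) and Corollary 3 (p. 53)]
[cite: Hartshorne1977, III Theorem 12.11 (p. 290)]
[cite: EGAIII2, 7.7.5 and 7.7.10]

Sequel to ★ `Morphisms/SectionsLiftOfFibreVanishing` (the SURJECTIVITY half: the pulled-back global sections span) and
★ `Modules/ModuleSectionsFlatBaseChange` (the FLAT case).  Setting: `g : X → B` proper and flat, `B` affine with LOCAL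
noetherian ring `Γ(B, 𝒪_B)` and residue field `k`, `G` finite locally free on `X`, and `Č•(𝓤, G) ⊗ k` exact in
degree `1` for some finite cover `𝓤` of `X` with affine finite intersections (supplied by `Ext¹(𝒪_{X₀}, G|_{X₀}) = 0`,
★ `function_exact_baseChange_residueField_of_subsingleton_ext`).

* §1 (algebra, Mumford §5 Lemma 2 + Cor. 3 at `i = 1`, injectivity half on the flat complex): for `R` local,
  `ψ : P• → C•` a quasi-isomorphism of complexes in degrees `[0, N]`, `P•` strictly perfect, `C•` termwise flat, `C• ⊗ k`
  exact in degree `1`: for EVERY `R`-algebra `B`, `B ⊗ Z⁰(C•) → B ⊗ C⁰` is INJECTIVE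
  (`injective_kerSubtype_baseChange_of_quasiIso_of_exact_one`; with ★
  `range_kerSubtype_baseChange_eq_ker_of_quasiIso_of_exact_one` this is `B ⊗ H⁰(C•) ≅ H⁰(C• ⊗ B)`).
* §2 (schemes): `injective_kerSubtype_baseChange_cechComplex`, and the base-change ISOMORPHISM
  **`exists_tensor_secMod_top_linearEquiv`**: for every cartesian square `X′ = X ×_B B′ → B′` over an affine `j : B′ → B`,
  `Γ(B′) ⊗_{Γ(B)} Γ(X, G) ≃ Γ(X′, k^*G)`, `b ⊗ t ↦ b · η(t)` (Mumford §5 Cor. 3 in degree `0`, in full; EGA III 7.7.5 II).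
* §3 cover-free headline `exists_tensor_secMod_top_linearEquiv_of_subsingleton_ext` (input `Ext¹(𝒪_{X₀}, G|_{X₀}) = 0` on
  the closed fibre, as in ★ `span_unitSectionLE_top_eq_top_of_subsingleton_ext`).

Everything is proved; no named facts; theorems only.  Universe `Scheme.{0}`.  Cell `hodgecm-mathlib`, F-DAG (h2) geometric
glue (B-p19 (g14)); consumer: the (h6-d) base-change hypothesis (hbc) of `Morphisms/ContainmentRepOfPushforward` (B-p04 (g19)),
which globalises this bijectivity.  HC_CM is proved only modulo the 7 printed citations until rung 0 closes — nothing here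
bears on a summit statement.

## References

* D. Mumford, *Abelian Varieties*, TIFR Studies in Mathematics 5 (1970), §5, Lemma 2 (p. 49), Cor. 3 (p. 53). [MumfordAV1970]
* R. Hartshorne, *Algebraic Geometry*, GTM 52 (1977), III Thm. 12.11 (p. 290). [Hartshorne1977]
* A. Grothendieck, EGA III₂ (Publ. Math. IHÉS 17, 1963), 7.7.5, 7.7.10. [EGAIII2]
* U. Görtz, T. Wedhorn, *Algebraic Geometry II* (2023), Cor. 23.135 (p. 355), Thm. 23.140. [GortzWedhorn2023]
-/

noncomputable section

set_option backward.isDefEq.respectTransparency false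

open CategoryTheory CategoryTheory.Limits CategoryTheory.Abelian Opposite TopologicalSpace AlgebraicGeometry TensorProduct
open Literature.Algebra.Homology Literature.Algebra.Module

universe u

/-! ## §1 Algebra: `B ⊗ Z⁰(C•) → B ⊗ C⁰` is injective -/

namespace Literature.Algebra.Homology

variable {R : Type u} [CommRing R] {P C : CochainComplex (ModuleCat.{u} R) ℤ} (ψ : P ⟶ C)

/-- **`B ⊗ H⁰(C•) → H⁰(C• ⊗ B)` is injective for every `B`, from `H¹(C• ⊗ k) = 0`** (Mumford §5 Lemma 2 + Cor. 3 at
`i = 1`, injectivity half, on the flat complex): `R` local with residue field `k`; `ψ : P• → C•` a quasi-isomorphism of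
complexes in degrees `[0, N]`, `P•` strictly perfect, `C•` termwise flat; if `C• ⊗ k` is exact in degree `1`, then for every
`R`-algebra `B` the map `B ⊗ Z⁰(C•) → B ⊗ C⁰` is injective.  (Proof: it is so for `P•` by ★
`kerBaseChange_of_exact_residueField_one_complex`; transport along the bijections `Z⁰(P•) → Z⁰(C•)` (★ `kerZeroMap_bijective`)
and `Ker(d⁰_P ⊗ B) → Ker(d⁰_C ⊗ B)` (★ `kerZeroBaseChangeMap_bijective`).)
[cite: MumfordAV1970, §5 Cor. 3 (p. 53)] [cite: Hartshorne1977, III Thm. 12.11 (p. 290)] -/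
theorem injective_kerSubtype_baseChange_of_quasiIso_of_exact_one [IsLocalRing R] [QuasiIso ψ] (N : ℤ)
    [P.IsStrictlyLE N] [C.IsStrictlyLE N] [P.IsStrictlyGE 0] [C.IsStrictlyGE 0]
    (hP : ∀ n, Module.Finite R (P.X n) ∧ Module.Projective R (P.X n)) (hC : ∀ n, Module.Flat R (C.X n))
    (hfib : Function.Exact ((C.d 0 1).hom.baseChange (IsLocalRing.ResidueField R))
      ((C.d 1 2).hom.baseChange (IsLocalRing.ResidueField R)))
    (B : Type u) [CommRing B] [Algebra R B] :
    Function.Injective ((LinearMap.ker (C.d 0 1).hom).subtype.baseChange B) := by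
  have hPf := flat_X_of_finite_projective hP
  have hfib' : Function.Exact ((C.d (1 - 1) 1).hom.baseChange (IsLocalRing.ResidueField R))
      ((C.d 1 (1 + 1)).hom.baseChange (IsLocalRing.ResidueField R)) := hfib
  have hfibP : Function.Exact ((P.d 0 1).hom.baseChange (IsLocalRing.ResidueField R))
      ((P.d 1 2).hom.baseChange (IsLocalRing.ResidueField R)) :=
    (function_exact_baseChange_iff_of_quasiIso ψ hPf hC N _ 1).2 hfib'
  have hPinj := ((kerBaseChange_of_exact_residueField_one_complex P hP hfibP).2.1 B).1
  have hbij := kerZeroBaseChangeMap_bijective ψ B hPf hC N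
  have hsurj : Function.Surjective ((kerZeroMap ψ).baseChange B) := by
    intro x
    obtain ⟨t, ht⟩ := LinearMap.lTensor_surjective B (kerZeroMap_bijective ψ).2 x
    exact ⟨t, by rw [LinearMap.baseChange_eq_ltensor]; exact ht⟩
  rw [injective_iff_map_eq_zero]
  intro x hx
  obtain ⟨t, rfl⟩ := hsurj x
  have h1 : ((LinearMap.ker (C.d 0 1).hom).subtype.baseChange B) ((kerZeroMap ψ).baseChange B t) =
      (ψ.f 0).hom.baseChange B (((LinearMap.ker (P.d 0 1).hom).subtype.baseChange B) t) := by
    rw [← LinearMap.comp_apply, ← LinearMap.baseChange_comp, kerSubtype_comp_kerZeroMap, LinearMap.baseChange_comp,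
      LinearMap.comp_apply]
  rw [h1] at hx
  have hw : ((LinearMap.ker (P.d 0 1).hom).subtype.baseChange B) t ∈ LinearMap.ker ((P.d 0 1).hom.baseChange B) :=
    range_kerSubtype_baseChange_le_ker P B 0 1 ⟨t, rfl⟩
  have hzero : kerZeroBaseChangeMap ψ B ⟨_, hw⟩ = 0 :=
    Subtype.ext (by rw [coe_kerZeroBaseChangeMap_apply]; exact hx)
  have hw0 : ((LinearMap.ker (P.d 0 1).hom).subtype.baseChange B) t = 0 :=
    congrArg Subtype.val (hbij.1 (hzero.trans (map_zero _).symm))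
  rw [hPinj (hw0.trans (map_zero _).symm), map_zero]

end Literature.Algebra.Homology

/-! ## §2 Schemes: `Γ(B′) ⊗ Γ(X, G) ≃ Γ(X′, k^*G)` over the local base -/

namespace Literature.AlgebraicGeometry.Morphisms

open Literature.AlgebraicGeometry.Modules Literature.AlgebraicGeometry.HodgeTheory Literature.AlgebraicGeometry.Motives

section Local

variable {X B : Scheme.{0}} (g : X ⟶ B) [IsAffine B] [IsProper g] [IsLocallyNoetherian B] [Flat g]
  [IsLocalRing Γ(B, ⊤)]
  {ι : Type} [LinearOrder ι] [Fintype ι] (U : ι → X.Opens) (hcov : ⨆ i, U i = ⊤)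
  (hUa : ∀ s : Finset ι, s.Nonempty → IsAffineOpen (cechOpen U s)) (G : X.Modules) (hL : IsFiniteLocallyFree G)
  (hfib : Function.Exact
    (((cechComplex U G g.appTop.hom).d 0 1).hom.baseChange (IsLocalRing.ResidueField Γ(B, ⊤)))
    (((cechComplex U G g.appTop.hom).d 1 2).hom.baseChange (IsLocalRing.ResidueField Γ(B, ⊤))))

include hcov hUa hL hfib in
/-- **`H⁰(Č•) ⊗ A′ → Č⁰ ⊗ A′` is injective for every algebra `A′`** over the LOCAL base ring, from the degree-`1` fibre
exactness alone (the Grothendieck complex of ★ `Modules/GrothendieckComplexOfProper` fed into §1).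
[cite: MumfordAV1970, §5 Cor. 3 (p. 53)] [cite: Hartshorne1977, III Thm. 12.11 (p. 290)] -/
theorem injective_kerSubtype_baseChange_cechComplex (A' : Type) [CommRing A'] [Algebra Γ(B, ⊤) A'] :
    Function.Injective ((LinearMap.ker ((cechComplex U G g.appTop.hom).d 0 1).hom).subtype.baseChange A') := by
  obtain ⟨K, ψ, hψ, hGE, hLE, hK⟩ :=
    exists_strictlyPerfect_quasiIso_cechComplex_of_isProper g U hcov hUa G hL (Fintype.card ι) (by omega)
  haveI := hψ
  haveI := hGE
  haveI := hLE
  haveI : (cechComplex U G g.appTop.hom).IsStrictlyLE (Fintype.card ι : ℤ) :=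
    isStrictlyLE_cechComplex U G _ (Fintype.card ι) (by omega)
  haveI : (cechComplex U G g.appTop.hom).IsStrictlyGE 0 := isStrictlyGE_cechComplex U G _
  exact injective_kerSubtype_baseChange_of_quasiIso_of_exact_one ψ (Fintype.card ι : ℤ) hK
    (flat_cechComplex_X U G _ (flat_secMod_of_flat g U hUa G hL)) hfib A'

include hcov hUa hL hfib in
/-- §2's input in the `OrderedCech.sysD` dialect of ★ `Modules/ModuleCechComplex`: `Γ(B′) ⊗ Z⁰ → Γ(B′) ⊗ Č⁰` is injective
with range `ker(d⁰ ⊗ Γ(B′))`. [cite: MumfordAV1970, §5 Cor. 3 (p. 53)] -/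
theorem injective_and_range_kerSubtype_baseChange_sysD (A' : Type) [CommRing A'] [Algebra Γ(B, ⊤) A'] :
    Function.Injective
        ((LinearMap.ker (OrderedCech.sysD (sectionsSystem U G g.appTop.hom) 0)).subtype.baseChange A') ∧
      LinearMap.range ((LinearMap.ker (OrderedCech.sysD (sectionsSystem U G g.appTop.hom) 0)).subtype.baseChange A') =
        LinearMap.ker ((OrderedCech.sysD (sectionsSystem U G g.appTop.hom) 0).baseChange A') := by
  have hd : ((cechComplex U G g.appTop.hom).d 0 1).hom = OrderedCech.sysD (sectionsSystem U G g.appTop.hom) 0 := by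
    change ((cechComplex U G g.appTop.hom).d 0 (0 + 1)).hom = _
    rw [OrderedCech.sysComplex_d]
    rfl
  have h1 := range_kerSubtype_baseChange_cechComplex_eq_ker g U hcov hUa G hL hfib A'
  have h2 := injective_kerSubtype_baseChange_cechComplex g U hcov hUa G hL hfib A'
  rw [hd] at h1 h2
  exact ⟨h2, h1⟩

variable {X' B' : Scheme.{0}} {g' : X' ⟶ B'} {k : X' ⟶ X} {j : B' ⟶ B} [IsAffine B'] (H : IsPullback k g' g j)

include hcov hUa hL hfib H in
/-- **`H⁰` COMMUTES WITH EVERY AFFINE BASE CHANGE when `H¹` of the closed fibre vanishes** (Mumford §5 Cor. 3 in degree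
`0` / Hartshorne III 12.11 / EGA III 7.7.5 II and 7.7.10): `g : X → B` proper flat, `B` affine with local noetherian ring,
`G` finite locally free, `Č•(𝓤, G) ⊗ k` exact in degree `1`.  Then for EVERY cartesian square over an affine `j : B′ → B`,
`Γ(B′) ⊗_{Γ(B)} Γ(X, G) ≃ Γ(X′, k^*G)`, `b ⊗ t ↦ b · η(t)`.
[cite: MumfordAV1970, §5 Cor. 3 (p. 53)] [cite: Hartshorne1977, III Thm. 12.11 (p. 290)] [cite: EGAIII2, 7.7.5] -/
theorem exists_tensor_secMod_top_linearEquiv :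
    letI := (j.appLE ⊤ ⊤ le_top).hom.toAlgebra
    ∃ E : Γ(B', ⊤) ⊗[Γ(B, ⊤)] SecMod G g.appTop.hom ⊤ ≃ₗ[Γ(B', ⊤)]
        SecMod ((Scheme.Modules.pullback k).obj G) g'.appTop.hom ⊤,
      ∀ (b : Γ(B', ⊤)) (t : SecMod G g.appTop.hom ⊤),
        E (b ⊗ₜ t) = b • SecMod.mk (ρ := g'.appTop.hom) (unitSectionLE k G (V := ⊤) (U := ⊤) le_top
          (SecMod.val (L := G) (ρ := g.appTop.hom) t)) := by
  letI := (j.appLE ⊤ ⊤ le_top).hom.toAlgebra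
  haveI := hL.isVectorBundle.1
  have hG : IsAffineLocalizing G := IsAffineLocalizing.of_isQuasicoherent G
  let ρ : Γ(B, ⊤) →+* Γ(X, ⊤) := g.appTop.hom
  let ρ' : Γ(B', ⊤) →+* Γ(X', ⊤) := g'.appTop.hom
  let d := OrderedCech.sysD (sectionsSystem U G ρ) 0
  obtain ⟨e', he'⟩ := exists_secMod_top_linearEquiv_ker_baseChange H U hUa G hcov hG
  obtain ⟨hinj, hrange⟩ := injective_and_range_kerSubtype_baseChange_sysD g U hcov hUa G hL hfib Γ(B', ⊤)
  -- `Γ(B') ⊗ Γ(X, G) ≃ Γ(B') ⊗ ker d⁰ ≃ ker(d⁰ ⊗ Γ(B')) ≃ Γ(X', k^*G)`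
  let E₁ : Γ(B', ⊤) ⊗[Γ(B, ⊤)] SecMod G ρ ⊤ ≃ₗ[Γ(B', ⊤)] Γ(B', ⊤) ⊗[Γ(B, ⊤)] LinearMap.ker d :=
    (kerDZeroEquiv U G ρ hcov).baseChange Γ(B, ⊤) Γ(B', ⊤) _ _
  let E₂ : Γ(B', ⊤) ⊗[Γ(B, ⊤)] LinearMap.ker d ≃ₗ[Γ(B', ⊤)] LinearMap.ker (d.baseChange Γ(B', ⊤)) :=
    LinearEquiv.ofBijective (((LinearMap.ker d).subtype.baseChange Γ(B', ⊤)).codRestrict _ fun y =>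
        hrange.le ⟨y, rfl⟩)
      ⟨fun x y hxy => hinj (congrArg Subtype.val hxy), fun z => by
        obtain ⟨y, hy⟩ := hrange.ge z.2
        exact ⟨y, Subtype.ext hy⟩⟩
  have hE₂ : ∀ y, ((E₂ y : LinearMap.ker (d.baseChange Γ(B', ⊤))) : Γ(B', ⊤) ⊗[Γ(B, ⊤)] OrderedCech.SysCochain
      (sectionsSystem U G ρ) 0) = ((LinearMap.ker d).subtype.baseChange Γ(B', ⊤)) y := fun _ => rfl
  refine ⟨E₁.trans (E₂.trans e'.symm), fun b t => ?_⟩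
  rw [LinearEquiv.trans_apply, LinearEquiv.trans_apply, LinearEquiv.symm_apply_eq]
  apply Subtype.ext
  rw [hE₂, map_smul, Submodule.coe_smul, he', TensorProduct.smul_tmul', smul_eq_mul, mul_one]
  change ((LinearMap.ker d).subtype.baseChange Γ(B', ⊤)) ((kerDZeroEquiv U G ρ hcov).baseChange Γ(B, ⊤) Γ(B', ⊤) _ _
    (b ⊗ₜ t)) = _
  rw [LinearEquiv.baseChange_tmul, LinearMap.baseChange_tmul, Submodule.subtype_apply]

include hcov hUa hL hfib H in
/-- **Injectivity form**: `Σ bᵢ · η(tᵢ) = 0` in `Γ(X′, k^*G)` only if `Σ bᵢ ⊗ tᵢ = 0` in `Γ(B′) ⊗ Γ(X, G)` — the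
`Γ(B′)`-linear extension of `t ↦ η(t)` is injective (with ★ `span_unitSectionLE_top_eq_top`, bijective).
[cite: MumfordAV1970, §5 Cor. 3 (p. 53)] [cite: Hartshorne1977, III Thm. 12.11 (p. 290)] -/
theorem injective_lift_unitSectionLE_top :
    letI := (j.appLE ⊤ ⊤ le_top).hom.toAlgebra
    ∀ F : Γ(B', ⊤) ⊗[Γ(B, ⊤)] SecMod G g.appTop.hom ⊤ →ₗ[Γ(B', ⊤)]
        SecMod ((Scheme.Modules.pullback k).obj G) g'.appTop.hom ⊤,
      (∀ (b : Γ(B', ⊤)) (t : SecMod G g.appTop.hom ⊤),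
        F (b ⊗ₜ t) = b • SecMod.mk (ρ := g'.appTop.hom) (unitSectionLE k G (V := ⊤) (U := ⊤) le_top
          (SecMod.val (L := G) (ρ := g.appTop.hom) t))) → Function.Injective F := by
  letI := (j.appLE ⊤ ⊤ le_top).hom.toAlgebra
  intro F hF
  obtain ⟨E, hE⟩ := exists_tensor_secMod_top_linearEquiv g U hcov hUa G hL hfib H
  have hFE : ∀ x, F x = E x := fun x => by
    induction x using TensorProduct.induction_on with
    | zero => rw [map_zero, map_zero]
    | tmul b t => rw [hF, hE]
    | add x y hx hy => rw [map_add, map_add, hx, hy]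
  intro x y hxy
  apply E.injective
  rw [← hFE, ← hFE]
  exact hxy

end Local

/-! ## §3 Cover-free headline: the closed fibre as a cartesian square identified with the residue field -/

section Headline

variable {X B : Scheme.{0}} (g : X ⟶ B) [IsAffine B] [IsProper g] [IsLocallyNoetherian B] [Flat g]
  [IsLocalRing Γ(B, ⊤)] (G : X.Modules) (hL : IsFiniteLocallyFree G)
  {X₀ B₀ : Scheme.{0}} {g₀ : X₀ ⟶ B₀} {k₀ : X₀ ⟶ X} {j₀ : B₀ ⟶ B} [IsAffine B₀] (H₀ : IsPullback k₀ g₀ g j₀)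
  (e₀ : letI := (j₀.appLE ⊤ ⊤ le_top).hom.toAlgebra
    IsLocalRing.ResidueField Γ(B, ⊤) ≃ₗ[Γ(B, ⊤)] Γ(B₀, ⊤))
  (hvan : Subsingleton (Ext.{1} (unitModule X₀) ((Scheme.Modules.pullback k₀).obj G) 1))

include H₀ e₀ hvan hL in
/-- **`H⁰` AND BASE CHANGE FROM `H¹` OF THE CLOSED FIBRE** (Mumford §5 Cor. 3 / Hartshorne III 12.11 / EGA III 7.7.5 II,
degree `0`, in full): `g : X → B` proper flat, `B` affine with LOCAL noetherian ring, `G` finite locally free,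
`X₀ = X ×_B B₀` the closed fibre (a cartesian square over an affine `j₀` identified with the residue field by `e₀`) with
`Ext¹(𝒪_{X₀}, G|_{X₀}) = 0`.  Then for EVERY cartesian square `X′ = X ×_B B′ → B′` over an affine `j : B′ → B`:
`Γ(B′) ⊗_{Γ(B)} Γ(X, G) ≃ Γ(X′, G|_{X′})`, `b ⊗ t ↦ b · η(t)`.
[cite: MumfordAV1970, §5 Cor. 3 (p. 53)] [cite: Hartshorne1977, III Thm. 12.11 (p. 290)] [cite: EGAIII2, 7.7.5] -/
theorem exists_tensor_secMod_top_linearEquiv_of_subsingleton_ext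
    {X' B' : Scheme.{0}} {g' : X' ⟶ B'} {k : X' ⟶ X} {j : B' ⟶ B} [IsAffine B'] (H : IsPullback k g' g j) :
    letI := (j.appLE ⊤ ⊤ le_top).hom.toAlgebra
    ∃ E : Γ(B', ⊤) ⊗[Γ(B, ⊤)] SecMod G g.appTop.hom ⊤ ≃ₗ[Γ(B', ⊤)]
        SecMod ((Scheme.Modules.pullback k).obj G) g'.appTop.hom ⊤,
      ∀ (b : Γ(B', ⊤)) (t : SecMod G g.appTop.hom ⊤),
        E (b ⊗ₜ t) = b • SecMod.mk (ρ := g'.appTop.hom) (unitSectionLE k G (V := ⊤) (U := ⊤) le_top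
          (SecMod.val (L := G) (ρ := g.appTop.hom) t)) := by
  obtain ⟨ι, _, _, U, hcov, hUa⟩ := exists_finite_affine_cover_cechOpen g
  haveI := hL.isVectorBundle.1
  have hG : IsAffineLocalizing G := IsAffineLocalizing.of_isQuasicoherent G
  exact exists_tensor_secMod_top_linearEquiv g U hcov hUa G hL
    (function_exact_baseChange_residueField_of_subsingleton_ext g G H₀ e₀ hvan U hcov hUa hG) H

include H₀ e₀ hvan hL in
/-- In particular (take `B′ = B₀` the closed point, `j₀♯` onto): **`k ⊗_{Γ(B)} Γ(X, G) ≃ Γ(X₀, G|_{X₀})`** — the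
restriction `t ↦ η(t)` identifies `Γ(X, G) ⊗ k` with the sections of the fibre (★
`surjective_unitSectionLE_top_of_subsingleton_ext` is its surjectivity).
[cite: MumfordAV1970, §5 Cor. 3 (p. 53)] [cite: Hartshorne1977, III Thm. 12.11 (p. 290), Cor. 12.9] -/
theorem exists_tensor_secMod_top_linearEquiv_closedFibre :
    letI := (j₀.appLE ⊤ ⊤ le_top).hom.toAlgebra
    ∃ E : Γ(B₀, ⊤) ⊗[Γ(B, ⊤)] SecMod G g.appTop.hom ⊤ ≃ₗ[Γ(B₀, ⊤)]
        SecMod ((Scheme.Modules.pullback k₀).obj G) g₀.appTop.hom ⊤,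
      ∀ (b : Γ(B₀, ⊤)) (t : SecMod G g.appTop.hom ⊤),
        E (b ⊗ₜ t) = b • SecMod.mk (ρ := g₀.appTop.hom) (unitSectionLE k₀ G (V := ⊤) (U := ⊤) le_top
          (SecMod.val (L := G) (ρ := g.appTop.hom) t)) :=
  exists_tensor_secMod_top_linearEquiv_of_subsingleton_ext g G hL H₀ e₀ hvan H₀

end Headline

end Literature.AlgebraicGeometry.Morphisms

end
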